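import Summits.BirchSwinnertonDyer.Rank1Residual.Supersingular.BlindInterpolationFlatTwoUnit
import Summits.BirchSwinnertonDyer.Rank1Residual.Supersingular.TamParityChi8Link
import Literature.NumberTheory.EllipticCurves.BSDRootNumberOddParityProofs
import Literature.NumberTheory.EllipticCurves.Sprung2017.SharpFlatPAdicLFunctionTwoProofs
import HarnessLib

/-!
# The parity law of the plus symbol at a good supersingular `2` (T-PAR2) and the parity coupling
# `g(0) ≡ g(−2) (mod 2)` of the blind doors at `p = 2` (cell `b2b-bsdres`, O1 sub-cell `p = 2`;
# cc-typer-4 GEN 11, typer item (33) of o1 lead ruling R-G34.6 = the γ-ANALYTIC half of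
# R-G21.3 γ; port of o1 refuter GEN 19's `W19-ParityCoupling.lean`, docket (17))

HONEST FRAMING (run/shared/lean/b2b/bsd-rank1-residual/, verbatim in every file): the goal of the
cell is to DELETE the COMBINATION-SHAPED residual classes of the Birch–Swinnerton-Dyer formula for
ALL analytic-rank `≤ 1` elliptic curves over `ℚ` — "full BSD formula for every rank `≤ 1` curve in
class `C`" assembled STRICTLY from published theorems — so that the rank-`≤ 1` remainder becomes
exactly the CONSTRUCTION-SHAPED classes, which are TYPED (missing-input `Prop`s), NOT attempted.
This is not "finishing BSD". THEOREMS ONLY about the tree's typed objects (`SignedDatum`,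
`IsSprungPair`, `mazurTateElement`, `ratPlusSymbol`, `BlindLever.evalAt`, `tamagawaProduct`);
every hypothesis explicit; nothing about any particular curve, Selmer group or `L`-function is
asserted; nothing booked; no label, count, price or tier moves; no definition, no named fact.

WHY. Every o1 blind door at `p = 2` reads ONE integral power series `g ∈ Λ = ℤ₂⟦T⟧` (the datum's
`L`, resp. `ξ`) at `T = 0` (trivial character) and at `T = −2` (the order-`2` character). Since
`g(−2) − g(0) ∈ 2ℤ₂` (`BlindLever.norm_evalAt_sub_constantCoeff_lt_one`), the two readings are
COUPLED mod `2`. This file records the consequences as tree theorems — the ANALYTIC half of the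
parity law R-G21.3 γ, next to its dictionary (algebraic) half `TamParityChi8Link.lean` — so that
the register's words for every `♭`-feeder ("the parity coupling `g(0) ≡ g(−2) (mod 2)` is
DISCHARGED by T-PAR2 + `TamParityChi8Link`") point at tree theorems BY NAME.

WHAT (composition only):
* §0 `2`-adic helpers (`g(−2) ≡ g(0) (mod 2)`; odd integers are units; `‖S‖₂ < 1 ⇒ 1 ≤ v₂(S)`).
* §1 the abstract door p290263 `BlindLever.bsdp_two_of_oneDivisibility_of_blindControl`: (P) +
  (P₋₂) + (C₋₂) at blind index `e ≥ 1` force `‖L(E,1)/Ω_E‖₂ < 1`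
  (`norm_lt_one_of_interpolation_of_blindInterpolation`), so its inputs are jointly unsatisfiable
  on a curve with `L(E,1)/Ω_E` a `2`-adic unit (`blindControl_inputs_false_of_norm_eq_one`); (K) +
  (K₋₂) at `e ≥ 1` force `2 ∣ Tam(E)·#Sel_{2^∞}(E)`
  (`two_dvd_tamagawa_mul_card_selmer_of_eulerCharacteristics`).
* §2 (newform level) `hSP : IsSprungPair f 2 a Ls Lf`, `a` even, `σ·χ₈(N) = +1` ⇒ `‖[0]⁺_f‖₂ < 1`:
  `Lf(0) = (−a²+2a+1)·[0]⁺_f` (the tree's `constantCoeff_flat_two_of_isCongrModOmega_zero`,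
  `BlindInterpolationFlatTwoUnit.lean` §1) is an odd multiple, and `2 ∣ Lf(−2)` (REMARK R-L1-G11
  `BlindLever.two_dvd_evalAt_flat_neg_two`).
* §3 (curve level) the door binders `{hf, hgood, ha, hsign, hSP}` of p297620 / p308053 force
  `‖[0]⁺_f‖₂ < 1`; with `hL`, `1 ≤ v₂([0]⁺_f)`; VACUITY LOCUS: `{hf, hgood, ha, hsign, hL, hSP}` is
  unsatisfiable on a curve with `v₂([0]⁺_f) ≤ 0`.
* §4 on the habitat `Tam(E)` is EVEN: `hgood`, `2 ∣ a₂`, `hL` (`⇒ w(E) = +1`), `hsign` (`⇒ χ₈(N_E)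
  = +1`) against the dictionary law `χ₈_conductorNorm_eq_neg_one_of_goodSS_two_of_odd_tamagawaProduct`.
* §5 **T-PAR2** `norm_ratPlusSymbol_zero_lt_one_of_sign : IsNewformOf W f →
  W.HasGoodReductionAtPrime 2 → 2 ∣ a₂(W) → w(W)·χ₈(N_W) = 1 → ‖[0]⁺_f‖₂ < 1`, UNCONDITIONALLY (the
  binder `hSP` is inhabited by the tree's `exists_isSprungPair_two`, Sprung 2017 at `p = 2`); the
  valuation form `1 ≤ v₂([0]⁺_f)` under `hL`; and `bsd_two_parity_coherence_of_sign` (both BSD₂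
  shadows — analytic `1 ≤ v₂(L(E,1)/Ω⁺_f)`, algebraic `2 ∣ Tam(E)` — hold on the T2 habitat; a
  coherence check of the mechanism, NOT a BSD statement).

CENSUS (EVIDENCE only, o1 refuter GEN 19, lens-1 G6 `SF2-ALL.sf2.tsv` × G10
`RESIDUE-COUNT-alpha-flat.json`; nothing here depends on it): `v₂(L♭(0)) ≥ 1` and `Tam(E)` even on
354 / 354 rows with `a₂ = ±2 ∧ w₈ = +1 ∧ r = 0` (196 / 196 on the (α♭) habitat of record); not a
tautology — `v₂(L♭(0)) = 0` on 154 / 739 rows of the sign-complement `w₈ = −1`; for `a₂ ∈ {0, ±2}`,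
`w₈ = +1`, rank `0`: `v₂([0]⁺_f) ≥ 1` on 530 / 530, and `= 0` on 270 / 1 157 rows with `w₈ = −1`.

CREDIT. o1 refuter GEN 19, `HOME/b2b-bsdres-o1-refuter/g19/lean/W19-ParityCoupling.lean` (sha256
`ba92a26365af0568…`, 440 l., farm rc 0; `g19/REFUTER-O1-v19.md` §§138–142) §§0–5 ported with every
STATEMENT token-for-token up to the namespace (`RefuterG19` ↦ `Supersingular`; three §0/§1 proofs
shortened); W19 §2's `zero_add_cyclotomicExponent_two` / `constantCoeff_flat_two_of_isCongrModOmega_zero`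
are the tree's (`BlindInterpolationFlatTwoUnit` §1, o1 refuter GEN 18) and are used by name; the
`#print axioms` pins are dropped (the gate records axioms per declaration; `[propext, Classical.choice,
Quot.sound]` checked on §1 / §5). References (shape only; nothing asserted): [Sprung2017] Thm. 1.12,
Cor. 4.4, Cor. 4.11; [Kobayashi2003] §3; [MurtyMurty1997] Ch. 6 §1. Folder record:
`HOME/cells/o1/PLAN.md` §40 C239–C241 (R-G34.6), precedent R-G21.3 γ (C159).
-/

set_option autoImplicit false

noncomputable section

open scoped Classical MatrixGroups ModularForm

open PowerSeries Polynomial CongruenceSubgroup WeierstrassCurve Literature.NumberTheory.EllipticCurves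
  Literature.NumberTheory.EllipticCurves.ModularForms
  Literature.NumberTheory.EllipticCurves.Sprung2017

namespace Summit.BirchSwinnertonDyer.Rank1Residual.Supersingular

/-! ### §0 Algebra in `ℤ₂⟦T⟧` and `ℚ₂` -/

section Algebra

/-- **`g(−2) ≡ g(0) (mod 2)`, norm form**: if `‖g(−2)‖ < 1` then `‖g(0)‖ < 1` (`g ∈ ℤ₂⟦T⟧`; the tree's
`BlindLever.norm_evalAt_sub_constantCoeff_lt_one`) (o1 refuter GEN 19, W19 §0). [folklore] -/
theorem norm_constantCoeff_lt_one_of_norm_evalAt_neg_two_lt_one {g : PowerSeries ℤ_[2]}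
    (h : ‖BlindLever.evalAt (-2 : ℤ_[2]) g‖ < 1) : ‖PowerSeries.constantCoeff g‖ < 1 := by
  have hsub := BlindLever.norm_evalAt_sub_constantCoeff_lt_one BlindLever.norm_neg_two_lt_one g
  rcases (PadicInt.norm_le_one (PowerSeries.constantCoeff g)).lt_or_eq with hc | hc
  · exact hc
  · exact absurd ((BlindLever.norm_eq_one_iff_of_norm_sub_lt_one hsub).mpr hc) h.ne

/-- **`g(−2) ≡ g(0) (mod 2)`**: if `2 ∣ g(−2)` then the constant term of `g ∈ ℤ₂⟦T⟧` is a non-unit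
(o1 refuter GEN 19, W19 §0). [folklore] -/
theorem norm_constantCoeff_lt_one_of_two_dvd_evalAt_neg_two {g : PowerSeries ℤ_[2]}
    (h : (2 : ℤ_[2]) ∣ BlindLever.evalAt (-2 : ℤ_[2]) g) : ‖PowerSeries.constantCoeff g‖ < 1 :=
  norm_constantCoeff_lt_one_of_norm_evalAt_neg_two_lt_one
    ((PadicInt.norm_lt_one_iff_dvd _).mpr (by exact_mod_cast h))

/-- An odd integer is a `2`-adic unit of `ℚ₂` (W19 §0). [folklore] -/
theorem norm_intCast_eq_one_of_odd {k : ℤ} (hk : ¬ (2 : ℤ) ∣ k) : ‖((k : ℤ) : ℚ_[2])‖ = 1 :=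
  le_antisymm (Padic.norm_int_le_one k)
    (not_lt.mp (mt Padic.norm_intCast_lt_one_iff.mp (by exact_mod_cast hk)))

/-- A rational with non-negative `2`-adic valuation has `‖·‖₂ ≤ 1` (W19 §0). [folklore] -/
theorem norm_ratCast_le_one_of_padicValRat_nonneg {S : ℚ} (hS : 0 ≤ padicValRat 2 S) :
    ‖((S : ℚ) : ℚ_[2])‖ ≤ 1 := by
  by_cases h0 : S = 0
  · subst h0; simp
  have hSQ : ((S : ℚ) : ℚ_[2]) ≠ 0 := by exact_mod_cast h0
  rw [Padic.norm_eq_zpow_neg_valuation hSQ, Padic.valuation_ratCast]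
  exact zpow_le_one_of_nonpos₀ (by norm_num) (by linarith)

/-- `‖S‖₂ < 1` for a non-zero rational means `1 ≤ v₂(S)` (W19 §0). [folklore] -/
theorem one_le_padicValRat_of_norm_lt_one {S : ℚ} (h0 : S ≠ 0) (h : ‖((S : ℚ) : ℚ_[2])‖ < 1) :
    1 ≤ padicValRat 2 S := by
  have hSQ : ((S : ℚ) : ℚ_[2]) ≠ 0 := by exact_mod_cast h0
  rw [Padic.norm_eq_zpow_neg_valuation hSQ, Padic.valuation_ratCast] at h
  by_contra hlt
  have : (1 : ℝ) ≤ (2 : ℝ) ^ (-padicValRat 2 S) := one_le_zpow₀ (by norm_num) (by omega)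
  exact absurd h (not_lt.mpr this)

/-- `‖(2 : ℚ₂) ^ e‖ ≤ 2⁻¹ < 1` for `1 ≤ e` (W19 §0). [folklore] -/
theorem norm_two_pow_le_half {e : ℕ} (he : 1 ≤ e) : ‖(2 : ℚ_[2]) ^ e‖ ≤ 2⁻¹ := by
  have h2 : ‖(2 : ℚ_[2])‖ = 2⁻¹ := by exact_mod_cast Padic.norm_p (p := 2)
  rw [norm_pow, h2]
  exact (pow_le_pow_of_le_one (by norm_num) (by norm_num) he).trans_eq (pow_one _)

/-- The coercion `ℤ₂ˣ → ℚ₂` lands in norm-one elements (W19 §0). [folklore] -/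
theorem norm_coe_units_eq_one (u : ℤ_[2]ˣ) : ‖(((u : ℤ_[2]) : ℤ_[2]) : ℚ_[2])‖ = 1 := by
  rw [PadicInt.padic_norm_e_of_padicInt]
  exact PadicInt.isUnit_iff.mp u.isUnit

end Algebra

/-! ### §1 The abstract door p290263 (o1 refuter GEN 19, W19 §1 = the register's p290263 ROW NOTE):
### (P) + (P₋₂) + (C₋₂) at `e ≥ 1` force `2 ∣ L(E,1)/Ω_E`; (K) + (K₋₂) force `2 ∣ Tam(E)·#Sel_{2^∞}(E)` -/

section AbstractDoor

variable {W : WeierstrassCurve ℚ}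

/-- **H_an-EVEN is forced.** For a signed datum `D` at `(E, 2)` with (P) `L(0) = c·t` (`t = L(E,1)/Ω_E`),
`2 ∤ c`, and the blind value law (P₋₂) `L(−2) = u′·2^e·S` at index `e ≥ 1` with `v₂(S) ≥ 0`:
`‖t‖₂ < 1`. (`L ∈ ℤ₂⟦T⟧`, so `L(0) ≡ L(−2) ≡ 0 (mod 2)`.) (o1 refuter GEN 19, W19 §1) [folklore] -/
theorem norm_lt_one_of_interpolation_of_blindInterpolation (D : SignedDatum W 2) (hc : ¬ 2 ∣ D.c)
    (hP : D.Interpolation) {S : ℚ} {e : ℕ} (hPb : D.BlindInterpolation S e) (he : 1 ≤ e)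
    (hS : 0 ≤ padicValRat 2 S) :
    ∃ t : ℚ, W.entireLFunction 1 / (W.realPeriodRat : ℂ) = (t : ℂ) ∧ ‖((t : ℚ) : ℚ_[2])‖ < 1 := by
  obtain ⟨t, ht, hL0⟩ := hP
  obtain ⟨u, hu⟩ := hPb
  refine ⟨t, ht, ?_⟩
  -- `‖L(−2)‖ < 1`
  have hev : ‖BlindLever.evalAt (-2 : ℤ_[2]) D.L‖ < 1 := by
    rw [← PadicInt.padic_norm_e_of_padicInt, hu, norm_mul, norm_mul, norm_coe_units_eq_one, one_mul]
    calc ‖(2 : ℚ_[2]) ^ e‖ * ‖((S : ℚ) : ℚ_[2])‖ ≤ 2⁻¹ * 1 :=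
          mul_le_mul (norm_two_pow_le_half he) (norm_ratCast_le_one_of_padicValRat_nonneg hS)
            (norm_nonneg _) (by norm_num)
      _ < 1 := by norm_num
  -- hence `‖L(0)‖ < 1`, and `L(0) = c · t` with `c` odd
  have hcc := norm_constantCoeff_lt_one_of_norm_evalAt_neg_two_lt_one hev
  rw [← PadicInt.padic_norm_e_of_padicInt, hL0, norm_mul] at hcc
  have hcodd : ‖((D.c : ℕ) : ℚ_[2])‖ = 1 := by
    have h := norm_intCast_eq_one_of_odd (k := (D.c : ℤ)) (by exact_mod_cast hc)
    exact_mod_cast h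
  rw [hcodd, one_mul] at hcc
  exact hcc

/-- **p290263's inputs are jointly unsatisfiable on a curve with `L(E,1)/Ω_E` a `2`-adic unit**, as soon as
the blind index is `e ≥ 1` (♯: `e = 1`, ♭: `e = 2`) and `v₂(S) ≥ 0` (automatic under (C₋₂)) (o1 refuter
GEN 19, W19 §1). [folklore] -/
theorem blindControl_inputs_false_of_norm_eq_one (D : SignedDatum W 2) (hc : ¬ 2 ∣ D.c)
    (hP : D.Interpolation) {S : ℚ} {e : ℕ} (hPb : D.BlindInterpolation S e) (he : 1 ≤ e)
    {Wd : WeierstrassCurve ℚ} (hCb : BlindLever.BlindDescentCertificate Wd S)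
    {t : ℚ} (ht : W.entireLFunction 1 / (W.realPeriodRat : ℂ) = (t : ℂ))
    (hunit : ‖((t : ℚ) : ℚ_[2])‖ = 1) : False := by
  obtain ⟨_, _, hv⟩ := hCb
  have hS : 0 ≤ padicValRat 2 S := by rw [hv]; positivity
  obtain ⟨t', ht', hlt⟩ := norm_lt_one_of_interpolation_of_blindInterpolation D hc hP hPb he hS
  have htt : t' = t := by
    have h : ((t' : ℚ) : ℂ) = ((t : ℚ) : ℂ) := by rw [← ht', ht]
    exact_mod_cast h
  rw [htt] at hlt
  exact absurd hunit hlt.ne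

/-- **H_alg-EVEN is forced.** For a signed datum `D` at `(E, 2)`: (K) at the trivial character with
`Sel_{2^∞}(E/ℚ)` finite and (K₋₂) at blind index `e ≥ 1` for a `ℚ`-model `Wd` of `E^{(2)}` with
`Sel_{2^∞}(E^{(2)}/ℚ)` finite force `2 ∣ Tam(E) · #Sel_{2^∞}(E/ℚ)` (`ξ ∈ ℤ₂⟦T⟧`, `ξ(0) ≡ ξ(−2) ≡ 0 (mod 2)`)
(o1 refuter GEN 19, W19 §1). [folklore] -/
theorem two_dvd_tamagawa_mul_card_selmer_of_eulerCharacteristics (D : SignedDatum W 2)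
    (hK : D.EulerCharacteristic) (hfin : Finite (W.selmerGroupPInfty 2))
    {Wd : WeierstrassCurve ℚ} {e : ℕ} (htw : ∃ C : VariableChange ℚ, C • W.quadraticTwist 2 = Wd)
    (hKb : D.BlindEulerCharacteristicAt Wd e) (hfind : Finite (Wd.selmerGroupPInfty 2)) (he : 1 ≤ e) :
    2 ∣ W.tamagawaProduct * Nat.card (W.selmerGroupPInfty 2) := by
  obtain ⟨u, hu⟩ := hK hfin
  obtain ⟨u', hu'⟩ := hKb htw hfind
  have h2le : ‖(2 : ℚ_[2])‖ ≤ 1 := by exact_mod_cast Padic.norm_int_le_one (p := 2) 2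
  have hT : ‖(2 : ℚ_[2]) ^ (padicValNat 2 Wd.tamagawaProduct)‖ ≤ 1 := by
    rw [norm_pow]; exact pow_le_one₀ (norm_nonneg _) h2le
  have hN : ‖((Nat.card (Wd.selmerGroupPInfty 2) : ℕ) : ℚ_[2])‖ ≤ 1 := by
    have h := Padic.norm_int_le_one (p := 2) (Nat.card (Wd.selmerGroupPInfty 2) : ℤ)
    exact_mod_cast h
  -- `‖ξ(−2)‖ ≤ 2⁻¹ < 1`
  have hev : ‖BlindLever.evalAt (-2 : ℤ_[2]) D.xi‖ < 1 := by
    rw [← PadicInt.padic_norm_e_of_padicInt, hu', norm_mul, norm_mul, norm_mul, norm_coe_units_eq_one,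
      one_mul]
    calc ‖(2 : ℚ_[2]) ^ e‖ * ‖(2 : ℚ_[2]) ^ (padicValNat 2 Wd.tamagawaProduct)‖ *
          ‖((Nat.card (Wd.selmerGroupPInfty 2) : ℕ) : ℚ_[2])‖ ≤ 2⁻¹ * 1 * 1 :=
          mul_le_mul (mul_le_mul (norm_two_pow_le_half he) hT (norm_nonneg _) (by norm_num)) hN
            (norm_nonneg _) (by norm_num)
      _ < 1 := by norm_num
  -- hence `‖ξ(0)‖ < 1`, i.e. the natural number `2^{v₂ Tam(E)} · #Sel(E)` is even
  have hcc := norm_constantCoeff_lt_one_of_norm_evalAt_neg_two_lt_one hev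
  rw [← PadicInt.padic_norm_e_of_padicInt, hu, mul_assoc, norm_mul, norm_coe_units_eq_one, one_mul,
    ← Nat.cast_pow, ← Nat.cast_mul] at hcc
  have hdvdN : 2 ∣ 2 ^ (padicValNat 2 W.tamagawaProduct) * Nat.card (W.selmerGroupPInfty 2) :=
    Padic.norm_natCast_lt_one_iff.mp hcc
  by_cases hv : padicValNat 2 W.tamagawaProduct = 0
  · rw [hv, pow_zero, one_mul] at hdvdN
    exact dvd_mul_of_dvd_right hdvdN _
  · exact dvd_mul_of_dvd_left (dvd_of_one_le_padicValNat (Nat.one_le_iff_ne_zero.mpr hv)) _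

end AbstractDoor

/-! ### §2 The ♭-pair at `2`: `hSP` + the sign condition force `‖[0]⁺_f‖₂ < 1` (o1 refuter GEN 19, W19 §2) -/

section Form

variable {N : ℕ} [NeZero N] {f : CuspForm (Gamma0 N) 2}

/-- **`hSP` + sign ⇒ `‖[0]⁺_f‖₂ < 1`.** For a rational newform `f` of odd level `N` with EVEN `a_2(f) = a`,
a sign `σ = ±1` with `f` Fricke-`(−σ)` and `σ·χ₈(N) = +1`, and ANY integral Sprung pair `(Ls, Lf)` at `2`:
`Lf(0) = (−a²+2a+1)·[0]⁺_f` (odd multiple; the tree's `constantCoeff_flat_two_of_isCongrModOmega_zero`) and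
`2 ∣ Lf(−2)` (REMARK R-L1-G11 `BlindLever.two_dvd_evalAt_flat_neg_two`), so `‖[0]⁺_f‖₂ < 1` (o1 refuter
GEN 19, W19 §2). [folklore] -/
theorem norm_ratPlusSymbol_zero_lt_one_of_isSprungPair_two (hf0 : IsNewform0 f) (hQ : coeffField f = ⊥)
    (hN2 : ¬ 2 ∣ N) {a : ℤ} (hap : cuspCoeff f 2 = a) (ha : (2 : ℤ) ∣ a) {σ : ℤ} (hσ : σ = 1 ∨ σ = -1)
    (hW : IsFrickeEigen N f (-(σ : ℂ))) (hsign : σ * ZMod.χ₈ (N : ZMod 8) = 1)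
    {Ls Lf : IwasawaAlgebra 2} (hSP : IsSprungPair f 2 a Ls Lf) :
    ‖((ratPlusSymbol f 0 : ℚ) : ℚ_[2])‖ < 1 := by
  have hcc := constantCoeff_flat_two_of_isCongrModOmega_zero hf0 hQ hN2 hap (hSP 0)
  have hlt : ‖PowerSeries.constantCoeff Lf‖ < 1 :=
    norm_constantCoeff_lt_one_of_two_dvd_evalAt_neg_two
      (BlindLever.two_dvd_evalAt_flat_neg_two hf0 hQ hN2 hap ha hσ hW hsign hSP)
  rw [← PadicInt.padic_norm_e_of_padicInt, hcc] at hlt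
  -- the multiplier `−a² + 2a + 1` is an odd integer
  obtain ⟨m, rfl⟩ := ha
  have hsplit : (((-((2 * m : ℤ) : ℚ) ^ 2 + 2 * ((2 * m : ℤ) : ℚ) + 1) * ratPlusSymbol f 0 : ℚ) : ℚ_[2]) =
      (((2 * (-2 * m ^ 2 + 2 * m) + 1 : ℤ) : ℤ) : ℚ_[2]) * ((ratPlusSymbol f 0 : ℚ) : ℚ_[2]) := by
    push_cast; ring
  have hodd : ¬ (2 : ℤ) ∣ 2 * (-2 * m ^ 2 + 2 * m) + 1 := by
    rw [dvd_add_right (dvd_mul_right 2 _)]; norm_num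
  rw [hsplit, norm_mul, norm_intCast_eq_one_of_odd hodd, one_mul] at hlt
  exact hlt

end Form

/-! ### §3 For the newform of an elliptic curve: the doors p297620 / p308053 (o1 refuter GEN 19, W19 §3) -/

section Curve

variable {W : WeierstrassCurve ℚ} [W.IsElliptic] [W.IsGloballyMinimal] [NeZero (W.conductorNorm ℤ)]
  {f : CuspForm (Gamma0 (W.conductorNorm ℤ)) 2}

/-- **The door binders `hf, hgood, ha, hsign, hSP` force `‖[0]⁺_f‖₂ < 1`** (W19 §3). [folklore] -/
theorem norm_ratPlusSymbol_zero_lt_one_of_isSprungPair_two_of_isNewformOf (hf : IsNewformOf W f)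
    (hgood : W.HasGoodReductionAtPrime 2) (ha : W.frobeniusTrace 2 = 2 ∨ W.frobeniusTrace 2 = -2)
    (hsign : W.rootNumber * ZMod.χ₈ (W.conductorNorm ℤ : ZMod 8) = 1) {Ls Lf : IwasawaAlgebra 2}
    (hSP : IsSprungPair f 2 (W.frobeniusTrace 2) Ls Lf) :
    ‖((ratPlusSymbol f 0 : ℚ) : ℚ_[2])‖ < 1 :=
  norm_ratPlusSymbol_zero_lt_one_of_isSprungPair_two hf.1 hf.coeffField_eq_bot
    (not_dvd_level_of_isNewformOf hf hgood) (cuspCoeff_eq_frobeniusTrace_of_isNewformOf_holds hf hgood)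
    (by rcases ha with h | h <;> simp [h]) W.rootNumber_eq_one_or
    (isFrickeEigen_neg_rootNumber hf) hsign hSP

/-- **With `hL` (`L(E,1) ≠ 0`): `1 ≤ v₂([0]⁺_f)`** — the NAMED necessary condition H_an-EVEN of every door
carrying `hSP : IsSprungPair f 2 (a₂(E)) Ls L` with `a₂(E) = ±2` and `w_E·χ₈(N_E) = +1` (W19 §3). [folklore] -/
theorem one_le_padicValRat_ratPlusSymbol_zero_of_isSprungPair_two (hf : IsNewformOf W f)
    (hgood : W.HasGoodReductionAtPrime 2) (ha : W.frobeniusTrace 2 = 2 ∨ W.frobeniusTrace 2 = -2)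
    (hsign : W.rootNumber * ZMod.χ₈ (W.conductorNorm ℤ : ZMod 8) = 1)
    (hL : W.entireLFunction 1 ≠ 0) {Ls Lf : IwasawaAlgebra 2}
    (hSP : IsSprungPair f 2 (W.frobeniusTrace 2) Ls Lf) : 1 ≤ padicValRat 2 (ratPlusSymbol f 0) := by
  have hs0 : ratPlusSymbol f 0 ≠ 0 := by
    intro h0
    apply hL
    rw [hf.entireLFunction_one_eq, h0]
    simp
  exact one_le_padicValRat_of_norm_lt_one hs0
    (norm_ratPlusSymbol_zero_lt_one_of_isSprungPair_two_of_isNewformOf hf hgood ha hsign hSP)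

/-- **Vacuity locus.** On a curve with `v₂([0]⁺_f) ≤ 0` (i.e. `L(E₀,1)/Ω(E₀)` odd for the optimal curve) the
binders `{hf, hgood, ha, hsign, hL, hSP}` common to p297620 and the repaired door p308053 are jointly
unsatisfiable (W19 §3). [folklore] -/
theorem sprungPairDoor_hypotheses_false_of_padicValRat_le_zero (hf : IsNewformOf W f)
    (hgood : W.HasGoodReductionAtPrime 2) (ha : W.frobeniusTrace 2 = 2 ∨ W.frobeniusTrace 2 = -2)
    (hsign : W.rootNumber * ZMod.χ₈ (W.conductorNorm ℤ : ZMod 8) = 1)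
    (hL : W.entireLFunction 1 ≠ 0) {Ls Lf : IwasawaAlgebra 2}
    (hSP : IsSprungPair f 2 (W.frobeniusTrace 2) Ls Lf) (h0 : padicValRat 2 (ratPlusSymbol f 0) ≤ 0) :
    False := by
  have h := one_le_padicValRat_ratPlusSymbol_zero_of_isSprungPair_two hf hgood ha hsign hL hSP
  omega

end Curve

/-! ### §4 On the habitat H_alg-EVEN is a THEOREM (tree dictionary law `TamParityChi8Link`; W19 §4) -/

section TamParity

variable (W : WeierstrassCurve ℚ) [W.IsElliptic] [W.IsGloballyMinimal]

/-- **`Tam(E)` is EVEN on the blind-door habitat.** Good reduction at `2` with `a₂(E)` even, `L(E,1) ≠ 0` and the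
doors' sign condition `w(E)·χ₈(N_E) = +1` force `2 ∣ Tam(E)`: `L(E,1) ≠ 0 ⇒ w(E) = +1 ⇒ χ₈(N_E) = +1`, whereas the
tree's dictionary law (lens-1 G9 packet C + rider 9a + (26a), `χ₈_conductorNorm_eq_neg_one_of_goodSS_two_of_odd_tamagawaProduct`)
gives `χ₈(N_E) = −1` when `Tam(E)` is odd (o1 refuter GEN 19, W19 §4). [folklore] -/
theorem two_dvd_tamagawaProduct_of_sign (hgood : W.HasGoodReductionAtPrime 2) (hss : (2 : ℤ) ∣ W.frobeniusTrace 2)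
    (hL : W.entireLFunction 1 ≠ 0) (hsign : W.rootNumber * ZMod.χ₈ (W.conductorNorm ℤ : ZMod 8) = 1) :
    2 ∣ W.tamagawaProduct := by
  by_contra hodd
  have hodd' : Odd W.tamagawaProduct := Nat.odd_iff.mpr (Nat.two_dvd_ne_zero.mp hodd)
  have hχ := χ₈_conductorNorm_eq_neg_one_of_goodSS_two_of_odd_tamagawaProduct W hgood hss hodd'
  have hw : W.rootNumber = 1 := by
    rcases W.rootNumber_eq_one_or with h | h
    · exact h
    · exact absurd (WeierstrassCurve.entireLFunction_one_eq_zero_of_rootNumber_eq_neg_one h) hL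
  rw [hw, one_mul, hχ] at hsign
  norm_num at hsign

/-- **H_alg-EVEN on the habitat, with no Selmer input**: `2 ∣ Tam(E) · #Sel_{2^∞}(E/ℚ)` (W19 §4). [folklore] -/
theorem two_dvd_tamagawa_mul_card_selmer_of_sign (hgood : W.HasGoodReductionAtPrime 2)
    (hss : (2 : ℤ) ∣ W.frobeniusTrace 2) (hL : W.entireLFunction 1 ≠ 0)
    (hsign : W.rootNumber * ZMod.χ₈ (W.conductorNorm ℤ : ZMod 8) = 1) :
    2 ∣ W.tamagawaProduct * Nat.card (W.selmerGroupPInfty 2) :=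
  dvd_mul_of_dvd_left (two_dvd_tamagawaProduct_of_sign W hgood hss hL hsign) _

/-- The door form (`ha : a₂(E) = ±2`) of `two_dvd_tamagawaProduct_of_sign` (W19 §4). [folklore] -/
theorem two_dvd_tamagawaProduct_of_frobeniusTrace_two (hgood : W.HasGoodReductionAtPrime 2)
    (ha : W.frobeniusTrace 2 = 2 ∨ W.frobeniusTrace 2 = -2) (hL : W.entireLFunction 1 ≠ 0)
    (hsign : W.rootNumber * ZMod.χ₈ (W.conductorNorm ℤ : ZMod 8) = 1) : 2 ∣ W.tamagawaProduct :=
  two_dvd_tamagawaProduct_of_sign W hgood (by rcases ha with h | h <;> simp [h]) hL hsign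

end TamParity

/-! ### §5 H_an-EVEN is a THEOREM on the habitat: T-PAR2 (tree: `exists_isSprungPair_two`, Sprung 2017 at
### `p = 2`; o1 refuter GEN 19, W19 §5) -/

section Unconditional

variable {W : WeierstrassCurve ℚ} [W.IsElliptic] [W.IsGloballyMinimal] [NeZero (W.conductorNorm ℤ)]
  {f : CuspForm (Gamma0 (W.conductorNorm ℤ)) 2}

/-- **T-PAR2 (the parity law of the plus symbol at a good supersingular `2`).** For the newform `f` of an elliptic
`E/ℚ` with good reduction at `2`, `a₂(E)` EVEN (`a₂ ∈ {0, ±2}`) and `w(E)·χ₈(N_E) = +1`: `‖[0]⁺_f‖₂ < 1`, i.e.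
`L(E,1)/Ω⁺_f ∈ 2ℤ₍₂₎`. Proof: Sprung's integral pair exists at `2` (`exists_isSprungPair_two`), its ♭-member has
`L♭(0) = (−a₂²+2a₂+1)[0]⁺_f` and `2 ∣ L♭(−2)` under the sign condition (R-L1-G11), and `L♭(0) ≡ L♭(−2) (mod 2)`.
Census (EVIDENCE, o1 refuter GEN 19): `v₂ ≥ 1` on 530 / 530 rank-0 rows of lens-1 `SF2-ALL` with `a₂ ∈ {0, ±2}`,
`w₈ = +1`; `v₂ = 0` on 270 / 1 157 rows with `w₈ = −1` (o1 refuter GEN 19, W19 §5). [folklore] -/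
theorem norm_ratPlusSymbol_zero_lt_one_of_sign (hf : IsNewformOf W f) (hgood : W.HasGoodReductionAtPrime 2)
    (ha : (2 : ℤ) ∣ W.frobeniusTrace 2) (hsign : W.rootNumber * ZMod.χ₈ (W.conductorNorm ℤ : ZMod 8) = 1) :
    ‖((ratPlusSymbol f 0 : ℚ) : ℚ_[2])‖ < 1 := by
  obtain ⟨Ls, Lf, hSP⟩ := exists_isSprungPair_two hf hgood ha
  exact norm_ratPlusSymbol_zero_lt_one_of_isSprungPair_two hf.1 hf.coeffField_eq_bot
    (not_dvd_level_of_isNewformOf hf hgood) (cuspCoeff_eq_frobeniusTrace_of_isNewformOf_holds hf hgood)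
    ha W.rootNumber_eq_one_or (isFrickeEigen_neg_rootNumber hf) hsign hSP

/-- **T-PAR2, valuation form**: with `L(E,1) ≠ 0`, `1 ≤ v₂([0]⁺_f)` (W19 §5). [folklore] -/
theorem one_le_padicValRat_ratPlusSymbol_zero_of_sign (hf : IsNewformOf W f)
    (hgood : W.HasGoodReductionAtPrime 2) (ha : (2 : ℤ) ∣ W.frobeniusTrace 2)
    (hsign : W.rootNumber * ZMod.χ₈ (W.conductorNorm ℤ : ZMod 8) = 1) (hL : W.entireLFunction 1 ≠ 0) :
    1 ≤ padicValRat 2 (ratPlusSymbol f 0) := by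
  have hs0 : ratPlusSymbol f 0 ≠ 0 := by
    intro h0
    apply hL
    rw [hf.entireLFunction_one_eq, h0]
    simp
  exact one_le_padicValRat_of_norm_lt_one hs0 (norm_ratPlusSymbol_zero_lt_one_of_sign hf hgood ha hsign)

/-- **BSD₂-parity coherence on the T2 habitat** (a check of the mechanism, NOT a BSD statement): under
`{hf, hgood, 2 ∣ a₂(E), hsign, hL}` BOTH the analytic shadow `1 ≤ v₂(L(E,1)/Ω⁺_f)` (modular symbols, T-PAR2) and the
algebraic shadow `2 ∣ Tam(E)` (Kodaira–Néron + `Δ ≡ 5 (mod 8)`, `TamParityChi8Link`) hold (o1 refuter GEN 19,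
W19 §5). [folklore] -/
theorem bsd_two_parity_coherence_of_sign (hf : IsNewformOf W f) (hgood : W.HasGoodReductionAtPrime 2)
    (ha : (2 : ℤ) ∣ W.frobeniusTrace 2) (hsign : W.rootNumber * ZMod.χ₈ (W.conductorNorm ℤ : ZMod 8) = 1)
    (hL : W.entireLFunction 1 ≠ 0) :
    1 ≤ padicValRat 2 (ratPlusSymbol f 0) ∧ 2 ∣ W.tamagawaProduct :=
  ⟨one_le_padicValRat_ratPlusSymbol_zero_of_sign hf hgood ha hsign hL,
    two_dvd_tamagawaProduct_of_sign W hgood ha hL hsign⟩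

end Unconditional

end Summit.BirchSwinnertonDyer.Rank1Residual.Supersingular

end
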